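import Summits.HodgeConjecture.HodgeConjecture.Theorems.R90S2ArchLocalCuspidalLemmas   -- S2-R13 Lemmas sibling (cand v1; NOT YET ★ — by-paste until filed): `isRegNonEllipticMat_out_mk`; re-exports the Defs
import HarnessLib

/-!
# R90-TF ∕ S2 «Ch11-arch» — `R90S2ArchOrbitalProductTie` (S2-R13 second sibling, dealer HANDOFF-S2.g7 step (3) «`IsOrbitalProductAt` tie», census D-S2-11 A2):
the LOCAL ⊗ AWAY product tie for class orbital integrals on `G_∞`, with NAMED projections, and architecture (B) as a PROVED corollary — cand v1, HOME PRE-TYPE (NOT filed)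

Cell `pub/hodgecm-mathlib`, HCML Track R90-TF, section S2 (base `R90-C11`), typist `R90-C11-typ1` (g3); crux h413 = `stmt-HodgeConjecture-24833`, route of record
`HCCMUnconditional`.  Split off `R90S2ArchLocalCuspidalLemmas` for the 400-line limit; same conventions (no socket, no instance, no notation, no `sorry`,
default heartbeats).

## CONTENTS
* `archProjAt H τc : G_∞ →* U(σ_τc H)(ℂ)` and `archProjAway H τc : G_∞ →* ∏_{w ≠ τc} U(σ_w H)(ℂ)` — the two projections along ★ `archPiEquivCM` as MONOID HOMS (so that
  `ConjClasses.map` applies); read-backs `archProjAt_apply`, `archProjAway_apply`, `archProjAway_apply_apply` (`rfl`); DEDUP HINGE `archProjAt_eq_archAt`: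
  `archProjAt` IS ★ `archAt` with the CM dischargers (★ `archAt_eq_eval_comp_archPiEquiv`).
* `isArchFactoredAt_iff_eq_mul` — the Defs binder `IsArchFactoredAt ι H τ f fτ fc` read as the function identity `f = (fτ ∘ archProjAt) · (fc ∘ archProjAway)`.
* `IsOrbitalProductAt H τc m mτ mc` (+ `_iff`) — FUBINI-AS-HYPOTHESIS in kit-law style (census D-S2-11 A2 with named projections): the class orbital integral of a
  factored test function for the family `m` on `G_∞` is the product of the class orbital integrals of its factors for `mτ` (at `τc`) and `mc` (away), at the
  projected classes.  A BINDER for the E1∕(U) road (J-S2-11↔E1: whoever constructs the kit families pays it); nobody pays it here; it is NOT a socket.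
* Architecture (B) as a THEOREM, never a hypothesis: `IsCuspidalAt.classOrbitalIntegral_eq_zero` — under the product tie, a test function CUSPIDAL AT `τ` (Defs binder
  `IsCuspidalAt`, architecture (A)) has vanishing GLOBAL class orbital integral at every class of `G_∞` whose `τ`-component is regular non-elliptic; the
  representative change rides on the class-function hinge ★ `isRegNonEllipticMat_of_isConj_archLocal` via `isRegNonEllipticMat_out_mk`.

HONEST LABEL: a hypothesis-to-conclusion lemma about binders; no orbital-integral factorization is PROVED for any concrete family (E1∕(U) content); HC_CM is
proved only modulo the 7 printed citations (2 remaining named inputs: hLiu418 = stmt-HodgeConjecture-24832, h413 = stmt-HodgeConjecture-24833) until rung 0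
closes.  Count-neutral.

References: [BorelJacquet1979] §4.1 (local components of factorizable functions; restricted tensor products); [Arthur1988InvariantTraceFormulaII] §7 (cuspidal
functions, splitting of orbital integrals of factorizable functions); [Rogawski1990] §3.1 p. 19, §14.4.
-/

set_option autoImplicit false
set_option linter.dupNamespace false

noncomputable section

open MeasureTheory NumberField NumberField.InfinitePlace CompactlySupported
open scoped Matrix MatrixGroups InnerProductSpace ComplexOrder
open Literature.NumberTheory.Automorphic Literature.NumberTheory.Automorphic.UnitaryGroup
open Literature.RepresentationTheory.KonnoKonno2007 Literature.RepresentationTheory.KonnoKonno2007.RealDualPair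
open Summit.HodgeConjecture.HodgeConjecture.Cruxes.H413.K2E1bGKCohomologyU21.U8 (IsDiscreteSeriesRep IsTemperedRep HasArchOpTrace)

namespace Summit.HodgeConjecture.HodgeConjecture.R90.S2

/-! ## The local ⊗ away product tie (D-S2-11) and architecture (B) as a corollary -/

section ProductTie

variable {L : Type} [Field L] [NumberField L] [IsCMField L] {N : ℕ} (H : Matrix (Fin N) (Fin N) L)
  (τc : {w : InfinitePlace L // w.IsComplex})

/-- **Projection to the `τc`-component** `G_∞ = U(H)(L ⊗ ℝ) →* U(σ_τc H)(ℂ)` along ★ `archPiEquivCM` (= ★ `archAt` in the CM dischargers, `archProjAt_eq_archAt`).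
[cite: BorelJacquet1979, §4.1] -/
def archProjAt : ↥(arch (↥(maximalRealSubfield L)) L (IsCMField.complexConj L) N H) →* ↥(archLocal L N H τc) :=
  (Pi.evalMonoidHom (fun w : {w : InfinitePlace L // w.IsComplex} => ↥(archLocal L N H w)) τc).comp
    (archPiEquivCM L H (N := N)).toMulEquiv.toMonoidHom

/-- **Projection AWAY from `τc`**: `G_∞ →* ∏_{w ≠ τc} U(σ_w H)(ℂ)` along ★ `archPiEquivCM`. [cite: BorelJacquet1979, §4.1] -/
def archProjAway : ↥(arch (↥(maximalRealSubfield L)) L (IsCMField.complexConj L) N H) →*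
    (∀ w : {w : {w : InfinitePlace L // w.IsComplex} // w ≠ τc}, ↥(archLocal L N H w.1)) :=
  (MonoidHom.pi fun w : {w : {w : InfinitePlace L // w.IsComplex} // w ≠ τc} =>
      Pi.evalMonoidHom (fun w' : {w : InfinitePlace L // w.IsComplex} => ↥(archLocal L N H w')) w.1).comp
    (archPiEquivCM L H (N := N)).toMulEquiv.toMonoidHom

/-- Read-back: `archProjAt H τc g = (archPiEquivCM g) τc`. [folklore] -/
theorem archProjAt_apply (g : ↥(arch (↥(maximalRealSubfield L)) L (IsCMField.complexConj L) N H)) :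
    archProjAt H τc g = archPiEquivCM L H (N := N) g τc := rfl

/-- Read-back: `archProjAway H τc g = fun w => (archPiEquivCM g) w.1`. [folklore] -/
theorem archProjAway_apply (g : ↥(arch (↥(maximalRealSubfield L)) L (IsCMField.complexConj L) N H)) :
    archProjAway H τc g =
      fun w : {w : {w : InfinitePlace L // w.IsComplex} // w ≠ τc} => archPiEquivCM L H (N := N) g w.1 := rfl

/-- Pointwise read-back: `archProjAway H τc g w = (archPiEquivCM g) w.1`. [folklore] -/
theorem archProjAway_apply_apply (g : ↥(arch (↥(maximalRealSubfield L)) L (IsCMField.complexConj L) N H))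
    (w : {w : {w : InfinitePlace L // w.IsComplex} // w ≠ τc}) :
    archProjAway H τc g w = archPiEquivCM L H (N := N) g w.1 := rfl

/-- DEDUP HINGE: `archProjAt` is ★ `archAt` with the CM dischargers (★ `archAt_eq_eval_comp_archPiEquiv`). [folklore] -/
theorem archProjAt_eq_archAt :
    ⇑(archProjAt H τc) =
      ⇑(archAt (↥(maximalRealSubfield L)) L (IsCMField.complexConj L) N H τc (UnitaryGroup.complexConj_smul_infinitePlace L τc.1)
        (IsCMField.complexConj_ne_one L)) := by
  rw [archAt_eq_eval_comp_archPiEquiv]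
  rfl

/-- `IsArchFactoredAt` in the named projections: `f` factors at `τ` iff `f = (fτ ∘ archProjAt) · (fc ∘ archProjAway)` as functions. [cite: BorelJacquet1979, §4.1] -/
theorem isArchFactoredAt_iff_eq_mul (ι : L →+* ℂ) (τ : CptPlace L ι)
    (f : ↥(arch (↥(maximalRealSubfield L)) L (IsCMField.complexConj L) N H) → ℂ)
    (fτ : ↥(archLocal L N H (cptToComplex L ι τ)) → ℂ)
    (fc : (∀ w : {w : {w : InfinitePlace L // w.IsComplex} // w ≠ cptToComplex L ι τ}, ↥(archLocal L N H w.1)) → ℂ) :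
    IsArchFactoredAt ι H τ f fτ fc ↔
      f = fun g => fτ (archProjAt H (cptToComplex L ι τ) g) * fc (archProjAway H (cptToComplex L ι τ) g) :=
  ⟨fun h => funext h, fun h g => congrFun h g⟩

/-- **THE LOCAL ⊗ AWAY PRODUCT TIE at `τc` (D-S2-11, Fubini-as-hypothesis, kit-law style like `ArchCoherence`)**: a GLOBAL orbital-measure family `m` on `G_∞` is the
product at `τc` of a local family `mτ` and an away-family `mc` if the class orbital integral of every FACTORED test function `(fτ ∘ archProjAt) · (fc ∘ archProjAway)`
is the product of the local and the away class orbital integrals at the projected classes (`ConjClasses.map`).  A BINDER for the E1∕(U) road (J-S2-11↔E1); nobody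
pays it in S2. [cite: Arthur1988InvariantTraceFormulaII, §7] [cite: BorelJacquet1979, §4.1] -/
def IsOrbitalProductAt
    [∀ γ : ↥(arch (↥(maximalRealSubfield L)) L (IsCMField.complexConj L) N H),
      MeasurableSpace (↥(arch (↥(maximalRealSubfield L)) L (IsCMField.complexConj L) N H) ⧸ Subgroup.centralizer ({γ} : Set _))]
    [∀ γ : ↥(archLocal L N H τc), MeasurableSpace (↥(archLocal L N H τc) ⧸ Subgroup.centralizer ({γ} : Set ↥(archLocal L N H τc)))]
    [∀ γ : (∀ w : {w : {w : InfinitePlace L // w.IsComplex} // w ≠ τc}, ↥(archLocal L N H w.1)),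
      MeasurableSpace ((∀ w : {w : {w : InfinitePlace L // w.IsComplex} // w ≠ τc}, ↥(archLocal L N H w.1)) ⧸
        Subgroup.centralizer ({γ} : Set _))]
    (m : OrbitalMeasureFamily ↥(arch (↥(maximalRealSubfield L)) L (IsCMField.complexConj L) N H))
    (mτ : OrbitalMeasureFamily ↥(archLocal L N H τc))
    (mc : OrbitalMeasureFamily (∀ w : {w : {w : InfinitePlace L // w.IsComplex} // w ≠ τc}, ↥(archLocal L N H w.1))) : Prop :=
  ∀ (fτ : ↥(archLocal L N H τc) → ℂ) (fc : (∀ w : {w : {w : InfinitePlace L // w.IsComplex} // w ≠ τc}, ↥(archLocal L N H w.1)) → ℂ)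
    (c : ConjClasses ↥(arch (↥(maximalRealSubfield L)) L (IsCMField.complexConj L) N H)),
    classOrbitalIntegral m (fun g => fτ (archProjAt H τc g) * fc (archProjAway H τc g)) c =
      classOrbitalIntegral mτ fτ (ConjClasses.map (archProjAt H τc) c) * classOrbitalIntegral mc fc (ConjClasses.map (archProjAway H τc) c)

/-- Unfolding of `IsOrbitalProductAt` (definitional). [folklore] -/
theorem isOrbitalProductAt_iff
    [∀ γ : ↥(arch (↥(maximalRealSubfield L)) L (IsCMField.complexConj L) N H),
      MeasurableSpace (↥(arch (↥(maximalRealSubfield L)) L (IsCMField.complexConj L) N H) ⧸ Subgroup.centralizer ({γ} : Set _))]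
    [∀ γ : ↥(archLocal L N H τc), MeasurableSpace (↥(archLocal L N H τc) ⧸ Subgroup.centralizer ({γ} : Set ↥(archLocal L N H τc)))]
    [∀ γ : (∀ w : {w : {w : InfinitePlace L // w.IsComplex} // w ≠ τc}, ↥(archLocal L N H w.1)),
      MeasurableSpace ((∀ w : {w : {w : InfinitePlace L // w.IsComplex} // w ≠ τc}, ↥(archLocal L N H w.1)) ⧸
        Subgroup.centralizer ({γ} : Set _))]
    (m : OrbitalMeasureFamily ↥(arch (↥(maximalRealSubfield L)) L (IsCMField.complexConj L) N H))
    (mτ : OrbitalMeasureFamily ↥(archLocal L N H τc))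
    (mc : OrbitalMeasureFamily (∀ w : {w : {w : InfinitePlace L // w.IsComplex} // w ≠ τc}, ↥(archLocal L N H w.1))) :
    IsOrbitalProductAt H τc m mτ mc ↔
      ∀ (fτ : ↥(archLocal L N H τc) → ℂ) (fc : (∀ w : {w : {w : InfinitePlace L // w.IsComplex} // w ≠ τc}, ↥(archLocal L N H w.1)) → ℂ)
        (c : ConjClasses ↥(arch (↥(maximalRealSubfield L)) L (IsCMField.complexConj L) N H)),
        classOrbitalIntegral m (fun g => fτ (archProjAt H τc g) * fc (archProjAway H τc g)) c =
          classOrbitalIntegral mτ fτ (ConjClasses.map (archProjAt H τc) c) *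
            classOrbitalIntegral mc fc (ConjClasses.map (archProjAway H τc) c) :=
  Iff.rfl

/-- **ARCHITECTURE (B) AS A COROLLARY** (HEADS v2 §B, retired as a socket; audit R-c hinge): under the product tie at `τ`, a test function CUSPIDAL AT `τ` has
vanishing GLOBAL class orbital integral at every conjugacy class of `G_∞` whose `τ`-component (of any representative — a class function, ★ p862685) is regular
non-elliptic. [cite: Arthur1988InvariantTraceFormulaII, §7] [cite: Rogawski1990, §3.1 p. 19] -/
theorem IsCuspidalAt.classOrbitalIntegral_eq_zero (ι : L →+* ℂ) (τ : CptPlace L ι)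
    [∀ γ : ↥(arch (↥(maximalRealSubfield L)) L (IsCMField.complexConj L) N H),
      MeasurableSpace (↥(arch (↥(maximalRealSubfield L)) L (IsCMField.complexConj L) N H) ⧸ Subgroup.centralizer ({γ} : Set _))]
    [∀ γ : ↥(archLocal L N H (cptToComplex L ι τ)),
      MeasurableSpace (↥(archLocal L N H (cptToComplex L ι τ)) ⧸ Subgroup.centralizer ({γ} : Set ↥(archLocal L N H (cptToComplex L ι τ))))]
    [∀ γ : (∀ w : {w : {w : InfinitePlace L // w.IsComplex} // w ≠ cptToComplex L ι τ}, ↥(archLocal L N H w.1)),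
      MeasurableSpace ((∀ w : {w : {w : InfinitePlace L // w.IsComplex} // w ≠ cptToComplex L ι τ}, ↥(archLocal L N H w.1)) ⧸
        Subgroup.centralizer ({γ} : Set _))]
    {m : OrbitalMeasureFamily ↥(arch (↥(maximalRealSubfield L)) L (IsCMField.complexConj L) N H)}
    {mτ : OrbitalMeasureFamily ↥(archLocal L N H (cptToComplex L ι τ))}
    {mc : OrbitalMeasureFamily (∀ w : {w : {w : InfinitePlace L // w.IsComplex} // w ≠ cptToComplex L ι τ}, ↥(archLocal L N H w.1))}
    (hprod : IsOrbitalProductAt H (cptToComplex L ι τ) m mτ mc)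
    {f : ↥(arch (↥(maximalRealSubfield L)) L (IsCMField.complexConj L) N H) → ℂ} (hf : IsCuspidalAt ι H τ mτ f)
    (c : ConjClasses ↥(arch (↥(maximalRealSubfield L)) L (IsCMField.complexConj L) N H))
    (hc : IsRegNonEllipticMat
      (((archProjAt H (cptToComplex L ι τ) (Quotient.out c) : ↥(archLocal L N H (cptToComplex L ι τ))) : GL (Fin N) ℂ) :
        Matrix (Fin N) (Fin N) ℂ)) :
    classOrbitalIntegral m f c = 0 := by
  obtain ⟨fτ, fc, hfac, hcusp⟩ := hf
  obtain rfl := (isArchFactoredAt_iff_eq_mul H ι τ f fτ fc).1 hfac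
  have hmk : ConjClasses.mk (Quotient.out c) = c := Quotient.out_eq c
  have hmap : ConjClasses.map (archProjAt H (cptToComplex L ι τ)) c =
      ConjClasses.mk (archProjAt H (cptToComplex L ι τ) (Quotient.out c)) := by
    conv_lhs => rw [← hmk]
    rfl
  have hreg : IsRegNonEllipticMat
      (((Quotient.out (ConjClasses.map (archProjAt H (cptToComplex L ι τ)) c) : ↥(archLocal L N H (cptToComplex L ι τ))) :
          GL (Fin N) ℂ) : Matrix (Fin N) (Fin N) ℂ) := by
    rw [hmap]
    exact (isRegNonEllipticMat_out_mk H (cptToComplex L ι τ) _).2 hc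
  rw [hprod fτ fc c, hcusp _ hreg, zero_mul]

end ProductTie

end Summit.HodgeConjecture.HodgeConjecture.R90.S2

end
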